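import Summits.QuantumFields.YangMills.Theorems.UnitScaleTiltHalvingCompetitorMapFibre
import Summits.QuantumFields.YangMills.Theorems.UnitScaleTiltProp8ChartKernelFlatTower
import Summits.QuantumFields.YangMills.Theorems.UnitScaleTiltProp8ChartDoubleBarBall
import Summits.QuantumFields.YangMills.Theorems.UnitScaleTiltProp8FlatOpsLettersAssembly
import HarnessLib

/-!
# Route `UnitScaleTilt`, crux K1 child «MinimiserStabilityRegPr» (stmt-QuantumFields-19200), registered stub `stub_halvingStep` (H), the S11∕S12 junction of the
# end-to-end knit — **THE (Φ-1′) FIBRE HALF OF THE LOCALISED COMPETITOR MAP, DISCHARGED FROM THE CHART** (LEAD ★w5-19200 g4 RULING L-1 (R1); census #45): for the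
# local competitor `Φloc X` (`= e^{iη♭(X − H(D X))}` on the charted bonds, `= uS • Umin` off them), **`∃ h ∈ SU(2)^{sites}, h • Φloc X ∈ 𝔅_k(V)`** — from (49) + `hHinv` +
# the linear constraint `Q X = Q A`, locality of the double bar, and the weighted ball.

Cell `ym3-torus` (HUMAN RULING D-0037, YM ladder rung R3 — continuum SU(2) YM₃ on the torus is a RUNG, not the Clay problem), width seat `ym-ust-19200-w1` gen 7.
`--supports stmt-QuantumFields-19200 --as helper`; def-free, 0 sorry, standard axioms; counts toward nothing by itself.

WHY `∃`-GAUGE (not «`uS⁻¹ • Φloc X ∈ regFibrePr V`» with a FIXED gauge): `fibre … V = {U | D_{n,K}U = V}` is exact descent and `D_{n,K}(Φloc X) = (q_X·(uS)_k) • V` with `q_X`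
the accumulated-frame quotient of ✓`HalvingCompetitorMapFrames`, which reads the deep (non-index) double-bar variables — free directions of the competitor set — so
`q_X ≠ 1` for generic `X`.  The minimality transfer survives the `∃` (§1).

WHAT IS PROVED (ns `…Theorems.HalvingCompetitorMapFibreLocal`).
* §1 ★ `hmin_of_hcrit_exists_gauge` — `Umin` minimises `𝒲` over `regFibrePr … ε₀ V` (`0 ≤ ε₀`), `Φ A′ = u • Umin`, every `Φ X` (`X ∈ T ∩ {RegPr ε₀ (Φ X)}`) has SOME `SU(2)`
  gauge copy in `𝔅_k(V)` ⟹ `A′` minimises `X ↦ 𝒲(Φ X)` over `T ∩ {RegPr ε₀ (Φ X)}`.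
* §2 ★★ `exists_gaugeAct_mem_fibre_local` — ✓`HalvingCompetitorMapFibre.exists_gaugeAct_mem_fibre` with its two inputs READ FROM A CHART: nested family `Dm` (`Dm.k = K − n`,
  collar clause), level weights `w`, radius `R` (`16·3800·ℓ²·L·R ≤ 1`), `Umin ∈ regFibrePr … ε₀ V` (`0 < ε₀`, `10⁷L³ε₀ ≤ 1`), `SU(2)` gauge `uS`, a bond predicate `Near`
  containing the read territory of every index bond of level `≥ 1` and of every `Ω_{j+1}`-block, fields `ZA`, `ZX` in the weighted `R`-ball with equal log-chart data
  `Q♭(ZX) = Q♭(ZA)` on the indices of level `≥ 1` and equal values on the charted `Λ₀`-bonds, a regular `W` with `W = e^{iη♭ZX}` on `Near`, `= uS • Umin` off `Near`,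
  `uS • Umin = e^{iη♭ZA}` on `Near` (`η♭ = L^{−(K−n)}`) ⟹ `∃ h, h • W ∈ fibre … V`.  Inside: index pinning (level 0 by values; level `≥ 1` by locality
  ✓`dbarIterU_congr_of_agree` + `exp ∘ mlog = id` ✓`MatrixLog.exp_mlog` on the ball of ✓`norm_dbarIterU_sub_one_le_two_mul₀`, `s₀ = 2R·L^{−i}` from the level weights through
  the collar clause) and near-flatness under the `Ω`-blocks (`s_j = 2R·L^{−(j+1)}`, budget = `hR`).
* §3 ★★★ `exists_gaugeAct_mem_fibre_of_chart49` — §2 in the letters of ✓`HalvingSitePackage.hpair_of_hcrit_local` (p625510): from FILE E's (49) clause `h49`, `hHinv`, the ball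
  clause `hball` and `bondAvgIter X = bondAvgIter A` on `BondIdx Dm` (`chartLogFlat_dressed_eq`: `Q♭(Y − H(D Y)) = Q♭′(0)Y`; level-`0` dressing vanishes by ✓`logTower_zero`),
  `∃ h, h • W ∈ fibre … V` for every regular `W` that is `e^{iη♭(X − H(D X))}` on `Near` and `uS • Umin` off it = the discharge of the REPAIRED L2′ binder
  `hΦ1 : ∀ X ∈ T, RegPr ε₀ (Φloc X) → ∃ h, h • Φloc X ∈ fibre … V`.
HONEST SCOPE: the two containment clauses of `Near` and the minimiser's membership∕regime are displayed; nothing of print is asserted; NOT a claim about the stub, the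
crux, the rung or a mass gap.

References: T. Bałaban, CMP **102** (1985) 277–309 [Balaban1985Variational] ((3)–(4), (6) p.278, (20) p.281, (44)–(49) p.285, (150) p.301, (152) p.301, (156)–(158) p.302);
CMP **98** (1985) 17–51 [Balaban1985Averaging] ((89) p.31, (110) p.34, (134)–(135) p.38); CMP **96** (1984) 223–250 [Balaban1984PropagatorsII] ((2.1)–(2.4) p.224).
-/

set_option autoImplicit false

noncomputable section

open scoped BigOperators Matrix.Norms.L2Operator
open NormedSpace

namespace Summit.QuantumFields.YangMills.Theorems.HalvingCompetitorMapFibreLocal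

open Literature.MathematicalPhysics.QuantumFieldTheory.Balaban1983to89
open Literature.MathematicalPhysics.QuantumFieldTheory.Balaban1983to89.T3ContinuumYM3Torus
open Literature.MathematicalPhysics.QuantumFieldTheory.Balaban1983to89.T3UnitLawDensityEML (ℰp)
open Literature.MathematicalPhysics.QuantumFieldTheory.Balaban1983to89.T3TiltDescent (descendTo)
open Literature.MathematicalPhysics.QuantumFieldTheory.Balaban1983to89.T3ConstrainedMinimiser (fibre)
open Literature.MathematicalPhysics.QuantumFieldTheory.Balaban1983to89.T3RegularMinimiser (regThreshold)
open Literature.MathematicalPhysics.QuantumFieldTheory.Balaban1983to89.T3PrintedRegularMinimiser (RegPr regFibrePr mem_regFibrePr_iff)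
open Literature.MathematicalPhysics.QuantumFieldTheory.Balaban1983to89.T3PrintedRegularOrbits (regPr_gaugeAct_iff)
open T4Continuum BlockAveraging ExpMeanLog
open MatrixLog (mlog exp_mlog)
open B10Eq27TorusAxialLog (unitsField val_unitsField toUField suIncl val_suIncl)
open B5Eq118OneStroke (iterBlockOf)
open B6SectADomainsV1 (Domains)
open B6SectAOperatorsV1 (BondIdx)
open B11Eq115Space (levOf le_levOf)
open LatticeFieldCalculus (bondAvgIter)
open B5Eq120IterProof (bondAvgIter_zero)
open FlatCubeOpsText (IsLevWeight)
open FlatOpsLettersAssembly (levWeight_nonneg)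
open Summit.QuantumFields.YangMills.Theorems.Prop8Chart (expCfg coe_expCfg)
open Summit.QuantumFields.YangMills.Theorems.Prop8ChartDoubleBar (dbarIterU dbarIterU_zero dbarIterU_congr_of_agree norm_dbarIterU_sub_one_le_two_mul₀ chartLogFlat
  chartLogFlat_apply fderiv_chartLogFlat_zero_apply)
open Summit.QuantumFields.YangMills.Theorems.HalvingCompetitorMapFibre (exists_gaugeAct_mem_fibre)

variable (F : T3Family) (n K : ℕ)

/-! ## §1 The minimality transfer with the `∃`-gauge fibre half -/

section Hmin

variable {F n K}
variable (Φ : (PBond (F.P K) 0 → Matrix (Fin 2) (Fin 2) ℂ) → GaugeField (F.P K) 0 (Matrix.specialUnitaryGroup (Fin 2) ℂ))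

/-- ★ **`hmin_of_hcrit` WITH THE `∃`-GAUGE FIBRE HALF**: if `Umin` minimises the Wilson action over print's regular fibre `regFibrePr … ε₀ V` (`0 ≤ ε₀`), `Φ A′ = u • Umin`, and every
competitor `Φ X` with `X ∈ T ∩ {RegPr ε₀ (Φ X)}` has SOME `SU(2)` gauge copy in the fibre `𝔅_k(V)`, then `A′` minimises `X ↦ 𝒲(Φ X)` over `T ∩ {RegPr ε₀ (Φ X)}` (`𝒲` and `RegPr` are
gauge invariant: lit ✓`wilsonAction_gaugeAct`, ✓`regPr_gaugeAct_iff`). [cite: Balaban1985Variational, (150) p.301, (157) p.302, p.278 (sentence after (3))] -/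
theorem hmin_of_hcrit_exists_gauge (hnK : n ≤ K) {ε₀ : ℝ} (hε : 0 ≤ ε₀) (V : GaugeField (F.P n) 0 (Matrix.specialUnitaryGroup (Fin 2) ℂ))
    {Umin : GaugeField (F.P K) 0 (Matrix.specialUnitaryGroup (Fin 2) ℂ)}
    (hcrit : IsMinOn (fun W : GaugeField (F.P K) 0 (Matrix.specialUnitaryGroup (Fin 2) ℂ) => wilsonAction4 W) (regFibrePr F n K hnK ε₀ V) Umin)
    (T : Set (PBond (F.P K) 0 → Matrix (Fin 2) (Fin 2) ℂ))
    (hfib : ∀ X ∈ T ∩ {X | RegPr F n K ε₀ (Φ X)}, ∃ h : GaugeTransf (F.P K) 0 (Matrix.specialUnitaryGroup (Fin 2) ℂ), GaugeField.gaugeAct h (Φ X) ∈ fibre F ℰp n K hnK V)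
    {A' : PBond (F.P K) 0 → Matrix (Fin 2) (Fin 2) ℂ} (u : GaugeTransf (F.P K) 0 (Matrix.specialUnitaryGroup (Fin 2) ℂ)) (hΦA : Φ A' = GaugeField.gaugeAct u Umin) :
    IsMinOn (fun X => wilsonAction4 (Φ X)) (T ∩ {X | RegPr F n K ε₀ (Φ X)}) A' := by
  intro X hX
  obtain ⟨h, hh⟩ := hfib X hX
  have hmem : GaugeField.gaugeAct h (Φ X) ∈ regFibrePr F n K hnK ε₀ V := (mem_regFibrePr_iff F).2 ⟨hh, (regPr_gaugeAct_iff F hε h (Φ X)).2 hX.2⟩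
  have h1 : wilsonAction4 Umin ≤ wilsonAction4 (GaugeField.gaugeAct h (Φ X)) := hcrit hmem
  show wilsonAction 1 (Φ A') ≤ wilsonAction 1 (Φ X)
  rw [hΦA, T4WilsonGaugeFlatDirection.wilsonAction_gaugeAct]
  rwa [show wilsonAction4 (GaugeField.gaugeAct h (Φ X)) = wilsonAction4 (Φ X) from T4WilsonGaugeFlatDirection.wilsonAction_gaugeAct 1 h (Φ X)] at h1

end Hmin

/-! ## §2 The fibre half read from a chart -/

section Local

variable {F n K}

/-- the units reading of an `SU(2)` bond variable is its matrix. [cite: Balaban1985Averaging, (19) p.21] -/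
theorem coe_unitsField_toUField (W : GaugeField (F.P K) 0 (Matrix.specialUnitaryGroup (Fin 2) ℂ)) (b : PBond (F.P K) 0) :
    ((unitsField (toUField W) b : (Matrix (Fin 2) (Fin 2) ℂ)ˣ) : Matrix (Fin 2) (Fin 2) ℂ) = ((W b : Matrix.specialUnitaryGroup (Fin 2) ℂ) : Matrix (Fin 2) (Fin 2) ℂ) := by
  rw [val_unitsField]
  exact val_suIncl _

/-- ★★ **THE FIBRE HALF READ FROM A CHART** — see the module docstring, §2. [cite: Balaban1985Variational, (3)-(4) p.278, (20) p.281, (44) p.285, (150) p.301, (152) p.301, (156) p.302;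
Balaban1985Averaging, (89) p.31, (134)-(135) p.38; Balaban1984PropagatorsII, (2.3)-(2.4) p.224] -/
theorem exists_gaugeAct_mem_fibre_local (Dm : Domains (F.P K)) (hDk : Dm.k = K - n)
    (hcollar : ∀ (i : ℕ) (e : PBond (F.P K) (i + 1)), Dm.LamBond (i + 1) e → ∀ z : Site (F.P K) i, (blockOf z = e.src ∨ blockOf z = e.tgt) → z ∈ Dm.Om i)
    {w : ℕ → PBond (F.P K) 0 → ℝ} (hw : IsLevWeight F n K Dm w)
    {R : ℝ} (hR : 16 * 3800 * ((((F.P K).d + 2) * (F.P K).L : ℕ) : ℝ) ^ 2 * (F.L : ℝ) * R ≤ 1)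
    (hnK : n ≤ K) {ε₀ : ℝ} (hε₀ : 0 < ε₀) (hε : 10 ^ 7 * (F.L : ℝ) ^ 3 * ε₀ ≤ 1)
    {V : GaugeField (F.P n) 0 (Matrix.specialUnitaryGroup (Fin 2) ℂ)} {Umin : GaugeField (F.P K) 0 (Matrix.specialUnitaryGroup (Fin 2) ℂ)}
    (hUmin : Umin ∈ regFibrePr F n K hnK ε₀ V) (uS : GaugeTransf (F.P K) 0 (Matrix.specialUnitaryGroup (Fin 2) ℂ))
    (Near : PBond (F.P K) 0 → Prop)
    (hNearIdx : ∀ idx : BondIdx Dm, 1 ≤ (idx.1.1 : ℕ) → ∀ b : PBond (F.P K) 0,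
      (iterBlockOf (idx.1.1 : ℕ) b.src = idx.1.2.src ∨ iterBlockOf (idx.1.1 : ℕ) b.src = idx.1.2.tgt) →
      (iterBlockOf (idx.1.1 : ℕ) b.tgt = idx.1.2.src ∨ iterBlockOf (idx.1.1 : ℕ) b.tgt = idx.1.2.tgt) → Near b)
    (hNearΩ : ∀ (j : ℕ) (z : Site (F.P K) (j + 1)), z ∈ Dm.Om (j + 1) → ∀ b : PBond (F.P K) 0, iterBlockOf (j + 1) b.src = z → iterBlockOf (j + 1) b.tgt = z → Near b)
    (ZA ZX : PBond (F.P K) 0 → Matrix (Fin 2) (Fin 2) ℂ) (hZA : ∀ b, w 1 b * ‖ZA b‖ < R) (hZX : ∀ b, w 1 b * ‖ZX b‖ < R)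
    (hlog : ∀ idx : BondIdx Dm, 1 ≤ (idx.1.1 : ℕ) → chartLogFlat (((F.L : ℝ))⁻¹ ^ (K - n)) Dm ZX idx = chartLogFlat (((F.L : ℝ))⁻¹ ^ (K - n)) Dm ZA idx)
    (hZ0 : ∀ b : PBond (F.P K) 0, Dm.LamBond 0 b → Near b → ZX b = ZA b)
    (W : GaugeField (F.P K) 0 (Matrix.specialUnitaryGroup (Fin 2) ℂ))
    (hWnear : ∀ b, Near b → ((W b : Matrix.specialUnitaryGroup (Fin 2) ℂ) : Matrix (Fin 2) (Fin 2) ℂ) = exp ((Complex.I * ((((F.L : ℝ))⁻¹ ^ (K - n) : ℝ) : ℂ)) • ZX b))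
    (hWfar : ∀ b, ¬ Near b → W b = GaugeField.gaugeAct uS Umin b)
    (hAnear : ∀ b, Near b → ((GaugeField.gaugeAct uS Umin b : Matrix.specialUnitaryGroup (Fin 2) ℂ) : Matrix (Fin 2) (Fin 2) ℂ) =
      exp ((Complex.I * ((((F.L : ℝ))⁻¹ ^ (K - n) : ℝ) : ℂ)) • ZA b))
    (hWreg : RegPr F n K ε₀ W) :
    ∃ h : GaugeTransf (F.P K) 0 (Matrix.specialUnitaryGroup (Fin 2) ℂ), GaugeField.gaugeAct h W ∈ fibre F ℰp n K hnK V := by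
  -- constants
  have hL1 : (1 : ℝ) ≤ (F.L : ℝ) := by exact_mod_cast F.hL.2.le
  have hL0 : (0 : ℝ) < (F.L : ℝ) := by linarith
  have hLne : (F.L : ℝ) ≠ 0 := hL0.ne'
  have hη0 : 0 ≤ ((F.L : ℝ))⁻¹ ^ (K - n) := pow_nonneg (inv_nonneg.2 hL0.le) _
  have hLinv0 : 0 ≤ ((F.L : ℝ))⁻¹ := inv_nonneg.2 hL0.le
  have hLinv1 : ((F.L : ℝ))⁻¹ ≤ 1 := inv_le_one_of_one_le₀ hL1
  have hLj : ∀ j : ℕ, (F.L : ℝ) ^ j * ((F.L : ℝ))⁻¹ ^ j = 1 := fun j => by rw [← mul_pow, mul_inv_cancel₀ hLne, one_pow]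
  have hR0 : 0 ≤ max R 0 := le_max_right _ _
  have hc : (1 : ℝ) ≤ ((((F.P K).d + 2) * (F.P K).L : ℕ) : ℝ) := by exact_mod_cast Nat.succ_le_of_lt (Nat.mul_pos (by omega) (F.P K).L_pos)
  have hℓ1 : (1 : ℝ) ≤ ((((F.P K).d + 2) * (F.P K).L : ℕ) : ℝ) ^ 2 := one_le_pow₀ hc
  have hR' : 16 * 3800 * ((((F.P K).d + 2) * (F.P K).L : ℕ) : ℝ) ^ 2 * (F.L : ℝ) * max R 0 ≤ 1 := by
    rcases le_total 0 R with h | h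
    · rwa [max_eq_left h]
    · rw [max_eq_right h, mul_zero]; exact zero_le_one
  -- `60800·(L·R⁺) ≤ 1`, `60800·R⁺ ≤ 1`
  have hLR : 60800 * ((F.L : ℝ) * max R 0) ≤ 1 := by
    nlinarith [mul_le_mul_of_nonneg_left hℓ1 (by positivity : (0 : ℝ) ≤ 60800 * ((F.L : ℝ) * max R 0))]
  have hR1 : max R 0 ≤ 1 := by nlinarith [le_mul_of_one_le_left hR0 hL1]
  -- the chart bound: `‖e^{iη♭Z(b)} − 1‖ ≤ 2R⁺L^{−j}` at a bond whose source lies in `Ω_j`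
  have hchart : ∀ (j : ℕ), j ≤ K - n → ∀ (Z : PBond (F.P K) 0 → Matrix (Fin 2) (Fin 2) ℂ), (∀ b, w 1 b * ‖Z b‖ < R) →
      ∀ b : PBond (F.P K) 0, Dm.InOm j b.src →
        ‖exp ((Complex.I * ((((F.L : ℝ))⁻¹ ^ (K - n) : ℝ) : ℂ)) • Z b) - 1‖ ≤ 2 * (max R 0 * ((F.L : ℝ))⁻¹ ^ j) := by
    intro j hj Z hZ b hb
    have hwb : ((F.L : ℝ))⁻¹ ^ (K - n) * (F.L : ℝ) ^ j ≤ w 1 b := by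
      rw [hw 1 b, pow_one, mul_comm]
      exact mul_le_mul_of_nonneg_right (pow_le_pow_right₀ hL1 (le_levOf (Ω := fun j => {x : Site (F.P K) 0 | Dm.InOm j x}) hj hb)) hη0
    have hnorm : ‖(Complex.I * ((((F.L : ℝ))⁻¹ ^ (K - n) : ℝ) : ℂ)) • Z b‖ = ((F.L : ℝ))⁻¹ ^ (K - n) * ‖Z b‖ := by
      rw [norm_smul, norm_mul, Complex.norm_I, one_mul, Complex.norm_real, Real.norm_of_nonneg hη0]
    have h1 : ((F.L : ℝ))⁻¹ ^ (K - n) * ‖Z b‖ ≤ ((F.L : ℝ))⁻¹ ^ j * (w 1 b * ‖Z b‖) := by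
      have h2 : ((F.L : ℝ))⁻¹ ^ j * (((F.L : ℝ))⁻¹ ^ (K - n) * (F.L : ℝ) ^ j * ‖Z b‖) =
          ((F.L : ℝ))⁻¹ ^ (K - n) * ‖Z b‖ * ((F.L : ℝ) ^ j * ((F.L : ℝ))⁻¹ ^ j) := by ring
      rw [hLj, mul_one] at h2
      rw [← h2]
      exact mul_le_mul_of_nonneg_left (mul_le_mul_of_nonneg_right hwb (norm_nonneg _)) (pow_nonneg hLinv0 _)
    have h3 : w 1 b * ‖Z b‖ ≤ max R 0 := (hZ b).le.trans (le_max_left _ _)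
    have hα : ‖(Complex.I * ((((F.L : ℝ))⁻¹ ^ (K - n) : ℝ) : ℂ)) • Z b‖ ≤ max R 0 * ((F.L : ℝ))⁻¹ ^ j := by
      rw [hnorm]
      calc ((F.L : ℝ))⁻¹ ^ (K - n) * ‖Z b‖ ≤ ((F.L : ℝ))⁻¹ ^ j * (w 1 b * ‖Z b‖) := h1
        _ ≤ ((F.L : ℝ))⁻¹ ^ j * max R 0 := mul_le_mul_of_nonneg_left h3 (pow_nonneg hLinv0 _)
        _ = max R 0 * ((F.L : ℝ))⁻¹ ^ j := mul_comm _ _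
    have hα1 : max R 0 * ((F.L : ℝ))⁻¹ ^ j ≤ 1 := (mul_le_of_le_one_right hR0 (pow_le_one₀ hLinv0 hLinv1)).trans hR1
    exact (B7TransferAnalyticMean.norm_exp_sub_one_le_two_mul (hα.trans hα1)).trans (mul_le_mul_of_nonneg_left hα zero_le_two)
  -- the minimiser: in the fibre, regular
  have hUV : descendTo F ℰp n K hnK Umin = V := ((mem_regFibrePr_iff F).1 hUmin).1
  have hUreg : RegPr F n K ε₀ Umin := ((mem_regFibrePr_iff F).1 hUmin).2
  -- values on the charted bonds, in the units
  have hWu : ∀ b, Near b → unitsField (toUField W) b = expCfg (((F.L : ℝ))⁻¹ ^ (K - n)) ZX b := fun b hb =>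
    Units.ext (by rw [coe_unitsField_toUField, coe_expCfg]; exact hWnear b hb)
  have hAu : ∀ b, Near b → unitsField (toUField (GaugeField.gaugeAct uS Umin)) b = expCfg (((F.L : ℝ))⁻¹ ^ (K - n)) ZA b := fun b hb =>
    Units.ext (by rw [coe_unitsField_toUField, coe_expCfg]; exact hAnear b hb)
  -- INDEX PINNING
  have hidxAux : ∀ (i : ℕ) (hi : i < Dm.k + 1) (c : PBond (F.P K) i) (hc : Dm.LamBond i c),
      dbarIterU i (unitsField (toUField W)) c = dbarIterU i (unitsField (toUField (GaugeField.gaugeAct uS Umin))) c := by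
    intro i hi c hc
    rcases i with _ | i
    · -- level 0: values
      rw [dbarIterU_zero, dbarIterU_zero]
      by_cases hN : Near c
      · rw [hWu c hN, hAu c hN]
        apply Units.ext
        rw [coe_expCfg, coe_expCfg, hZ0 c hc hN]
      · apply Units.ext
        rw [coe_unitsField_toUField, coe_unitsField_toUField, hWfar c hN]
    · -- level i+1: locality, the ball, `exp ∘ mlog = id`
      have hi' : i + 1 ≤ Dm.k := by omega
      have hiK : i + 1 ≤ (F.P K).m + (F.P K).K := hi'.trans Dm.hk
      have hikn : i ≤ K - n := by omega
      let idx : BondIdx Dm := ⟨⟨⟨i + 1, hi⟩, c⟩, hc⟩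
      have hread : ∀ b : PBond (F.P K) 0, (iterBlockOf (i + 1) b.src = c.src ∨ iterBlockOf (i + 1) b.src = c.tgt) →
          (iterBlockOf (i + 1) b.tgt = c.src ∨ iterBlockOf (i + 1) b.tgt = c.tgt) → Near b := hNearIdx idx (Nat.le_add_left 1 i)
      have hW' : dbarIterU (i + 1) (unitsField (toUField W)) c = dbarIterU (i + 1) (expCfg (((F.L : ℝ))⁻¹ ^ (K - n)) ZX) c :=
        dbarIterU_congr_of_agree (i + 1) hiK c fun b hs ht => hWu b (hread b hs ht)
      have hA' : dbarIterU (i + 1) (unitsField (toUField (GaugeField.gaugeAct uS Umin))) c = dbarIterU (i + 1) (expCfg (((F.L : ℝ))⁻¹ ^ (K - n)) ZA) c :=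
        dbarIterU_congr_of_agree (i + 1) hiK c fun b hs ht => hAu b (hread b hs ht)
      rw [hW', hA']
      -- the ball: `‖U̿^{(i+1)}(e^{iη♭Z})(c) − 1‖ < 1` for `Z` in the weighted `R`-ball
      have hsmall : ∀ Z : PBond (F.P K) 0 → Matrix (Fin 2) (Fin 2) ℂ, (∀ b, w 1 b * ‖Z b‖ < R) →
          ‖((dbarIterU (i + 1) (expCfg (((F.L : ℝ))⁻¹ ^ (K - n)) Z) c : (Matrix (Fin 2) (Fin 2) ℂ)ˣ) : Matrix (Fin 2) (Fin 2) ℂ) - 1‖ < 1 := by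
        intro Z hZ
        have hs₀ : (0 : ℝ) ≤ 2 * (max R 0 * ((F.L : ℝ))⁻¹ ^ i) := by positivity
        have hbud : 8 * 3800 * ((((F.P K).d + 2) * (F.P K).L : ℕ) : ℝ) ^ 2 * ((F.P K).L : ℝ) ^ (i + 1) * (2 * (max R 0 * ((F.L : ℝ))⁻¹ ^ i)) ≤ 1 := by
          show 8 * 3800 * ((((F.P K).d + 2) * (F.P K).L : ℕ) : ℝ) ^ 2 * (F.L : ℝ) ^ (i + 1) * (2 * (max R 0 * ((F.L : ℝ))⁻¹ ^ i)) ≤ 1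
          have h1 : 8 * 3800 * ((((F.P K).d + 2) * (F.P K).L : ℕ) : ℝ) ^ 2 * (F.L : ℝ) ^ (i + 1) * (2 * (max R 0 * ((F.L : ℝ))⁻¹ ^ i)) =
              16 * 3800 * ((((F.P K).d + 2) * (F.P K).L : ℕ) : ℝ) ^ 2 * (F.L : ℝ) * max R 0 * ((F.L : ℝ) ^ i * ((F.L : ℝ))⁻¹ ^ i) := by ring
          rw [h1, hLj, mul_one]
          exact hR'
        have hU : ∀ b : PBond (F.P K) 0, iterBlockOf (i + 1) b.src ∈ {y : Site (F.P K) (i + 1) | y = c.src ∨ y = c.tgt} →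
            iterBlockOf (i + 1) b.tgt ∈ {y : Site (F.P K) (i + 1) | y = c.src ∨ y = c.tgt} →
            ‖((expCfg (((F.L : ℝ))⁻¹ ^ (K - n)) Z b : (Matrix (Fin 2) (Fin 2) ℂ)ˣ) : Matrix (Fin 2) (Fin 2) ℂ) - 1‖ ≤ 2 * (max R 0 * ((F.L : ℝ))⁻¹ ^ i) := by
          intro b hs _
          have hIn : Dm.InOm i b.src := hcollar i c hc (iterBlockOf i b.src) hs
          rw [coe_expCfg]
          exact hchart i hikn Z hZ b hIn
        have h := norm_dbarIterU_sub_one_le_two_mul₀ hiK {y : Site (F.P K) (i + 1) | y = c.src ∨ y = c.tgt} (expCfg (((F.L : ℝ))⁻¹ ^ (K - n)) Z) hs₀ hbud hU c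
          (Or.inl rfl) (Or.inr rfl)
        have h2 : 2 * (((F.P K).L : ℝ) ^ (i + 1) * (2 * (max R 0 * ((F.L : ℝ))⁻¹ ^ i))) = 4 * ((F.L : ℝ) * max R 0) * ((F.L : ℝ) ^ i * ((F.L : ℝ))⁻¹ ^ i) := by
          show 2 * ((F.L : ℝ) ^ (i + 1) * (2 * (max R 0 * ((F.L : ℝ))⁻¹ ^ i))) = _
          ring
        rw [h2, hLj, mul_one] at h
        linarith
      -- equal logs, hence equal values
      have hl : (-Complex.I) • mlog (((dbarIterU (i + 1) (expCfg (((F.L : ℝ))⁻¹ ^ (K - n)) ZX) c : (Matrix (Fin 2) (Fin 2) ℂ)ˣ) : Matrix (Fin 2) (Fin 2) ℂ)) =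
          (-Complex.I) • mlog (((dbarIterU (i + 1) (expCfg (((F.L : ℝ))⁻¹ ^ (K - n)) ZA) c : (Matrix (Fin 2) (Fin 2) ℂ)ˣ) : Matrix (Fin 2) (Fin 2) ℂ)) := by
        have h := hlog idx (Nat.le_add_left 1 i)
        rw [chartLogFlat_apply, chartLogFlat_apply] at h
        exact h
      have hl' := smul_right_injective (Matrix (Fin 2) (Fin 2) ℂ) (neg_ne_zero.2 Complex.I_ne_zero) hl
      apply Units.ext
      calc ((dbarIterU (i + 1) (expCfg (((F.L : ℝ))⁻¹ ^ (K - n)) ZX) c : (Matrix (Fin 2) (Fin 2) ℂ)ˣ) : Matrix (Fin 2) (Fin 2) ℂ)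
          = exp (mlog (((dbarIterU (i + 1) (expCfg (((F.L : ℝ))⁻¹ ^ (K - n)) ZX) c : (Matrix (Fin 2) (Fin 2) ℂ)ˣ) : Matrix (Fin 2) (Fin 2) ℂ))) :=
            (exp_mlog (hsmall ZX hZX)).symm
        _ = exp (mlog (((dbarIterU (i + 1) (expCfg (((F.L : ℝ))⁻¹ ^ (K - n)) ZA) c : (Matrix (Fin 2) (Fin 2) ℂ)ˣ) : Matrix (Fin 2) (Fin 2) ℂ))) := by rw [hl']
        _ = _ := exp_mlog (hsmall ZA hZA)
  have hidx : ∀ idx : BondIdx Dm, dbarIterU (idx.1.1 : ℕ) (unitsField (toUField W)) idx.1.2 =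
      dbarIterU (idx.1.1 : ℕ) (unitsField (toUField (GaugeField.gaugeAct uS Umin))) idx.1.2 := by
    intro idx
    obtain ⟨⟨⟨i, hi⟩, c⟩, hc⟩ := idx
    exact hidxAux i hi c hc
  -- NEAR-FLATNESS under the `Ω`-blocks
  have hlev : ∀ (j : ℕ) (z : Site (F.P K) (j + 1)), z ∈ Dm.Om (j + 1) → j + 1 ≤ K - n := by
    intro j z hz
    rw [← hDk]
    by_contra hlt
    rw [Dm.Om_eq_empty (by omega)] at hz
    exact absurd hz (Finset.notMem_empty _)
  have hflat : ∀ (Z : PBond (F.P K) 0 → Matrix (Fin 2) (Fin 2) ℂ), (∀ b, w 1 b * ‖Z b‖ < R) →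
      ∀ (Y : GaugeField (F.P K) 0 (Matrix.specialUnitaryGroup (Fin 2) ℂ)),
      (∀ b, Near b → ((Y b : Matrix.specialUnitaryGroup (Fin 2) ℂ) : Matrix (Fin 2) (Fin 2) ℂ) = exp ((Complex.I * ((((F.L : ℝ))⁻¹ ^ (K - n) : ℝ) : ℂ)) • Z b)) →
      ∀ (j : ℕ) (z : Site (F.P K) (j + 1)), z ∈ Dm.Om (j + 1) → ∀ b : PBond (F.P K) 0, iterBlockOf (j + 1) b.src = z → iterBlockOf (j + 1) b.tgt = z →
        ‖((Y b : Matrix.specialUnitaryGroup (Fin 2) ℂ) : Matrix (Fin 2) (Fin 2) ℂ) - 1‖ ≤ 2 * (max R 0 * ((F.L : ℝ))⁻¹ ^ (j + 1)) := by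
    intro Z hZ Y hY j z hz b hs ht
    have hIn : Dm.InOm (j + 1) b.src := by show iterBlockOf (j + 1) b.src ∈ Dm.Om (j + 1); rw [hs]; exact hz
    rw [hY b (hNearΩ j z hz b hs ht)]
    exact hchart (j + 1) (hlev j z hz) Z hZ b hIn
  have hs0 : ∀ j : ℕ, 0 ≤ 2 * (max R 0 * ((F.L : ℝ))⁻¹ ^ (j + 1)) := fun j => by positivity
  have hbudget : ∀ j : ℕ, 8 * 3800 * ((((F.P K).d + 2) * (F.P K).L : ℕ) : ℝ) ^ 2 * ((F.P K).L : ℝ) ^ (j + 1) * (2 * (max R 0 * ((F.L : ℝ))⁻¹ ^ (j + 1))) ≤ 1 := by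
    intro j
    show 8 * 3800 * ((((F.P K).d + 2) * (F.P K).L : ℕ) : ℝ) ^ 2 * (F.L : ℝ) ^ (j + 1) * (2 * (max R 0 * ((F.L : ℝ))⁻¹ ^ (j + 1))) ≤ 1
    have h1 : 8 * 3800 * ((((F.P K).d + 2) * (F.P K).L : ℕ) : ℝ) ^ 2 * (F.L : ℝ) ^ (j + 1) * (2 * (max R 0 * ((F.L : ℝ))⁻¹ ^ (j + 1))) =
        16 * 3800 * ((((F.P K).d + 2) * (F.P K).L : ℕ) : ℝ) ^ 2 * max R 0 * ((F.L : ℝ) ^ (j + 1) * ((F.L : ℝ))⁻¹ ^ (j + 1)) := by ring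
    rw [h1, hLj, mul_one]
    have h2 : 16 * 3800 * ((((F.P K).d + 2) * (F.P K).L : ℕ) : ℝ) ^ 2 * max R 0 ≤ 16 * 3800 * ((((F.P K).d + 2) * (F.P K).L : ℕ) : ℝ) ^ 2 * max R 0 * (F.L : ℝ) :=
      le_mul_of_one_le_right (by positivity) hL1
    linarith
  -- ASSEMBLE
  obtain ⟨h, hh⟩ := exists_gaugeAct_mem_fibre F n K hnK Dm hDk hε₀ hε W Umin hWreg.plaqSmall hUreg.plaqSmall uS hidx
    (fun j => 2 * (max R 0 * ((F.L : ℝ))⁻¹ ^ (j + 1))) hs0 hbudget (hflat ZX hZX W hWnear) (hflat ZA hZA (GaugeField.gaugeAct uS Umin) hAnear)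
  exact ⟨h, by rw [← hUV]; exact hh⟩

end Local

/-! ## §3 In the letters of `hpair_of_hcrit_local`: from (49), `hHinv`, the ball and the linear constraint -/

section Chart49

variable {F n K}

/-- **THE LOG-CHART DATA OF A DRESSED COMPETITOR ARE ITS LINEAR DATA**: (49) `Q♭(Y − H(D Y)) − Q♭′(0)(Y − H(D Y)) = D Y` with `Q♭′(0) ∘ H = id` give `Q♭(Y − H(D Y)) = Q♭′(0) Y`.
[cite: Balaban1985Variational, (47)-(49) p.285, (45) p.285] -/
theorem chartLogFlat_dressed_eq (Dm : Domains (F.P K)) (η : ℝ)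
    (H : (BondIdx Dm → Matrix (Fin 2) (Fin 2) ℂ) →ₗ[ℂ] (PBond (F.P K) 0 → Matrix (Fin 2) (Fin 2) ℂ))
    (D : (PBond (F.P K) 0 → Matrix (Fin 2) (Fin 2) ℂ) → (BondIdx Dm → Matrix (Fin 2) (Fin 2) ℂ))
    (hHinv : ∀ Y : BondIdx Dm → Matrix (Fin 2) (Fin 2) ℂ,
      (fderiv ℂ (chartLogFlat η Dm : (PBond (F.P K) 0 → Matrix (Fin 2) (Fin 2) ℂ) → BondIdx Dm → Matrix (Fin 2) (Fin 2) ℂ) 0) (H Y) = Y)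
    {Y : PBond (F.P K) 0 → Matrix (Fin 2) (Fin 2) ℂ}
    (h49 : (fun (Z : PBond (F.P K) 0 → Matrix (Fin 2) (Fin 2) ℂ) => chartLogFlat η Dm Z -
      (fderiv ℂ (chartLogFlat η Dm : (PBond (F.P K) 0 → Matrix (Fin 2) (Fin 2) ℂ) → BondIdx Dm → Matrix (Fin 2) (Fin 2) ℂ) 0) Z) (Y - H (D Y)) = D Y) :
    chartLogFlat η Dm (Y - H (D Y)) =
      (fderiv ℂ (chartLogFlat η Dm : (PBond (F.P K) 0 → Matrix (Fin 2) (Fin 2) ℂ) → BondIdx Dm → Matrix (Fin 2) (Fin 2) ℂ) 0) Y := by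
  have h : chartLogFlat η Dm (Y - H (D Y)) -
      (fderiv ℂ (chartLogFlat η Dm : (PBond (F.P K) 0 → Matrix (Fin 2) (Fin 2) ℂ) → BondIdx Dm → Matrix (Fin 2) (Fin 2) ℂ) 0) (Y - H (D Y)) = D Y := h49
  rw [map_sub, hHinv] at h
  have h' := eq_add_of_sub_eq h
  rw [h']
  abel

/-- ★★★ **THE REPAIRED BINDER `hΦ1` OF L2′, DISCHARGED**: in the letters of ✓`HalvingSitePackage.hpair_of_hcrit_local` — nested family `Dm` (`Dm.k = K − n`, collar clause), level
weights `w`, chart radius `R` (`16·3800·ℓ²·L·R ≤ 1`), FILE E's (49) clause `h49`, the right inverse `hHinv`, the ball clause `hball`, the base point `A` and a competitor `X` in the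
`r₁`-ball with the SAME linear data on `BondIdx Dm`; the minimiser `Umin ∈ regFibrePr … ε₀ V` (`0 < ε₀`, `10⁷L³ε₀ ≤ 1`), the `SU(2)` gauge `uS` with the chart identity
`uS • Umin = e^{iη♭(A − H(D A))}` on `Near` (`η♭ = L^{−(K−n)}`), the two containment clauses of `Near`; THEN every REGULAR `W` that is `e^{iη♭(X − H(D X))}` on `Near` and
`uS • Umin` off `Near` has an `SU(2)` gauge copy in the fibre: `∃ h, h • W ∈ fibre … V`. [cite: Balaban1985Variational, (3)-(4) p.278, (44)-(49) p.285, (150) p.301,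
(152) p.301, (156)-(158) p.302; Balaban1985Averaging, (89) p.31, (134)-(135) p.38; Balaban1984PropagatorsII, (2.3)-(2.4) p.224] -/
theorem exists_gaugeAct_mem_fibre_of_chart49 (Dm : Domains (F.P K)) (hDk : Dm.k = K - n)
    (hcollar : ∀ (i : ℕ) (e : PBond (F.P K) (i + 1)), Dm.LamBond (i + 1) e → ∀ z : Site (F.P K) i, (blockOf z = e.src ∨ blockOf z = e.tgt) → z ∈ Dm.Om i)
    {w : ℕ → PBond (F.P K) 0 → ℝ} (hw : IsLevWeight F n K Dm w)
    {R : ℝ} (hR : 16 * 3800 * ((((F.P K).d + 2) * (F.P K).L : ℕ) : ℝ) ^ 2 * (F.L : ℝ) * R ≤ 1)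
    (H : (BondIdx Dm → Matrix (Fin 2) (Fin 2) ℂ) →ₗ[ℂ] (PBond (F.P K) 0 → Matrix (Fin 2) (Fin 2) ℂ))
    (D : (PBond (F.P K) 0 → Matrix (Fin 2) (Fin 2) ℂ) → (BondIdx Dm → Matrix (Fin 2) (Fin 2) ℂ))
    {r₁ : ℝ}
    (h49 : ∀ X : PBond (F.P K) 0 → Matrix (Fin 2) (Fin 2) ℂ, (∀ b, w 1 b * ‖X b‖ < r₁) → (fun (Z : PBond (F.P K) 0 → Matrix (Fin 2) (Fin 2) ℂ) =>
      chartLogFlat ((((F.L : ℝ))⁻¹) ^ (K - n)) Dm Z - (fderiv ℂ (chartLogFlat ((((F.L : ℝ))⁻¹) ^ (K - n)) Dm : (PBond (F.P K) 0 → Matrix (Fin 2) (Fin 2) ℂ) →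
        BondIdx Dm → Matrix (Fin 2) (Fin 2) ℂ) 0) Z) (X - H (D X)) = D X)
    (hHinv : ∀ Y : BondIdx Dm → Matrix (Fin 2) (Fin 2) ℂ, (fderiv ℂ (chartLogFlat ((((F.L : ℝ))⁻¹) ^ (K - n)) Dm : (PBond (F.P K) 0 → Matrix (Fin 2) (Fin 2) ℂ) →
      BondIdx Dm → Matrix (Fin 2) (Fin 2) ℂ) 0) (H Y) = Y)
    (hball : ∀ X : PBond (F.P K) 0 → Matrix (Fin 2) (Fin 2) ℂ, (∀ b, w 1 b * ‖X b‖ < r₁) → ∀ b, w 1 b * ‖(X - H (D X)) b‖ < R)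
    {A : PBond (F.P K) 0 → Matrix (Fin 2) (Fin 2) ℂ} (hAS : ∀ b, w 1 b * ‖A b‖ < r₁)
    {X : PBond (F.P K) 0 → Matrix (Fin 2) (Fin 2) ℂ} (hXS : ∀ b, w 1 b * ‖X b‖ < r₁)
    (hXQ : ∀ c : BondIdx Dm, bondAvgIter (c.1.1 : ℕ) X c.1.2 = bondAvgIter (c.1.1 : ℕ) A c.1.2)
    (hnK : n ≤ K) {ε₀ : ℝ} (hε₀ : 0 < ε₀) (hε : 10 ^ 7 * (F.L : ℝ) ^ 3 * ε₀ ≤ 1)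
    {V : GaugeField (F.P n) 0 (Matrix.specialUnitaryGroup (Fin 2) ℂ)} {Umin : GaugeField (F.P K) 0 (Matrix.specialUnitaryGroup (Fin 2) ℂ)}
    (hUmin : Umin ∈ regFibrePr F n K hnK ε₀ V) (uS : GaugeTransf (F.P K) 0 (Matrix.specialUnitaryGroup (Fin 2) ℂ))
    (Near : PBond (F.P K) 0 → Prop)
    (hNearIdx : ∀ idx : BondIdx Dm, 1 ≤ (idx.1.1 : ℕ) → ∀ b : PBond (F.P K) 0,
      (iterBlockOf (idx.1.1 : ℕ) b.src = idx.1.2.src ∨ iterBlockOf (idx.1.1 : ℕ) b.src = idx.1.2.tgt) →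
      (iterBlockOf (idx.1.1 : ℕ) b.tgt = idx.1.2.src ∨ iterBlockOf (idx.1.1 : ℕ) b.tgt = idx.1.2.tgt) → Near b)
    (hNearΩ : ∀ (j : ℕ) (z : Site (F.P K) (j + 1)), z ∈ Dm.Om (j + 1) → ∀ b : PBond (F.P K) 0, iterBlockOf (j + 1) b.src = z → iterBlockOf (j + 1) b.tgt = z → Near b)
    (hchartNear : ∀ b, Near b → ((GaugeField.gaugeAct uS Umin b : Matrix.specialUnitaryGroup (Fin 2) ℂ) : Matrix (Fin 2) (Fin 2) ℂ) =
      exp ((Complex.I * ((((F.L : ℝ))⁻¹ ^ (K - n) : ℝ) : ℂ)) • (A - H (D A)) b))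
    (W : GaugeField (F.P K) 0 (Matrix.specialUnitaryGroup (Fin 2) ℂ))
    (hWnear : ∀ b, Near b → ((W b : Matrix.specialUnitaryGroup (Fin 2) ℂ) : Matrix (Fin 2) (Fin 2) ℂ) = exp ((Complex.I * ((((F.L : ℝ))⁻¹ ^ (K - n) : ℝ) : ℂ)) • (X - H (D X)) b))
    (hWfar : ∀ b, ¬ Near b → W b = GaugeField.gaugeAct uS Umin b)
    (hWreg : RegPr F n K ε₀ W) :
    ∃ h : GaugeTransf (F.P K) 0 (Matrix.specialUnitaryGroup (Fin 2) ℂ), GaugeField.gaugeAct h W ∈ fibre F ℰp n K hnK V := by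
  have hL1 : (1 : ℝ) ≤ (F.L : ℝ) := by exact_mod_cast F.hL.2.le
  have hL0 : (0 : ℝ) < (F.L : ℝ) := by linarith
  have hη0 : 0 ≤ ((F.L : ℝ))⁻¹ ^ (K - n) := pow_nonneg (inv_nonneg.2 hL0.le) _
  have hηne : ((((F.L : ℝ))⁻¹ ^ (K - n) : ℝ) : ℂ) ≠ 0 := by exact_mod_cast (pow_pos (inv_pos.2 hL0) (K - n)).ne'
  -- (a) the weight floor and the window `R ≤ 1/5`
  have hwfloor : ∀ b : PBond (F.P K) 0, ((F.L : ℝ))⁻¹ ^ (K - n) ≤ w 1 b := fun b => by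
    rw [hw 1 b, pow_one]
    exact le_mul_of_one_le_left hη0 (one_le_pow₀ hL1)
  have hR5 : R ≤ 1 / 5 := by
    by_cases hR0 : R ≤ 0
    · linarith
    have hc : (1 : ℝ) ≤ ((((F.P K).d + 2) * (F.P K).L : ℕ) : ℝ) := by
      exact_mod_cast Nat.succ_le_of_lt (Nat.mul_pos (by omega) (F.P K).L_pos)
    have hc2 : (1 : ℝ) ≤ ((((F.P K).d + 2) * (F.P K).L : ℕ) : ℝ) ^ 2 * (F.L : ℝ) := one_le_mul_of_one_le_of_one_le (one_le_pow₀ hc) hL1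
    have h1 : 16 * 3800 * R ≤ 16 * 3800 * ((((F.P K).d + 2) * (F.P K).L : ℕ) : ℝ) ^ 2 * (F.L : ℝ) * R := by nlinarith
    linarith
  -- (b) the log-chart data of the dressed competitors are the linear data, equal for `X` and `A`
  have hkey : ∀ Y : PBond (F.P K) 0 → Matrix (Fin 2) (Fin 2) ℂ, (∀ b, w 1 b * ‖Y b‖ < r₁) → chartLogFlat ((((F.L : ℝ))⁻¹) ^ (K - n)) Dm (Y - H (D Y)) =
      (fderiv ℂ (chartLogFlat ((((F.L : ℝ))⁻¹) ^ (K - n)) Dm : (PBond (F.P K) 0 → Matrix (Fin 2) (Fin 2) ℂ) → BondIdx Dm → Matrix (Fin 2) (Fin 2) ℂ) 0) Y :=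
    fun Y hY => chartLogFlat_dressed_eq Dm _ H D hHinv (h49 Y hY)
  have hlog : ∀ idx : BondIdx Dm, 1 ≤ (idx.1.1 : ℕ) →
      chartLogFlat (((F.L : ℝ))⁻¹ ^ (K - n)) Dm (X - H (D X)) idx = chartLogFlat (((F.L : ℝ))⁻¹ ^ (K - n)) Dm (A - H (D A)) idx := fun idx _ => by
    rw [hkey X hXS, hkey A hAS, fderiv_chartLogFlat_zero_apply, fderiv_chartLogFlat_zero_apply, hXQ idx]
  -- (c) the level-0 dressing vanishes on the ball: `(Y − H(D Y))(b) = Y(b)` on `Λ₀`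
  have hZ : ∀ Y : PBond (F.P K) 0 → Matrix (Fin 2) (Fin 2) ℂ, (∀ b, w 1 b * ‖Y b‖ < r₁) → ∀ (b : PBond (F.P K) 0), Dm.LamBond 0 b → (Y - H (D Y)) b = Y b := by
    intro Y hY b hb
    have hsmall : ‖((((((F.L : ℝ))⁻¹ ^ (K - n) : ℝ)) : ℂ) • (Y - H (D Y))) b‖ ≤ 1 / 5 := by
      rw [Pi.smul_apply, norm_smul, Complex.norm_real, Real.norm_of_nonneg hη0]
      have h1 : ((F.L : ℝ))⁻¹ ^ (K - n) * ‖(Y - H (D Y)) b‖ ≤ w 1 b * ‖(Y - H (D Y)) b‖ := mul_le_mul_of_nonneg_right (hwfloor b) (norm_nonneg _)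
      linarith [hball Y hY b]
    have h := congr_fun (hkey Y hY) ⟨⟨⟨0, Nat.succ_pos _⟩, b⟩, hb⟩
    rw [chartLogFlat_apply, fderiv_chartLogFlat_zero_apply] at h
    have h' : (-Complex.I) • mlog (((dbarIterU 0 (expCfg (((F.L : ℝ))⁻¹ ^ (K - n)) (Y - H (D Y)))) b : (Matrix (Fin 2) (Fin 2) ℂ)ˣ) : Matrix (Fin 2) (Fin 2) ℂ) =
        ((((((F.L : ℝ))⁻¹ ^ (K - n) : ℝ)) : ℂ) * (((F.P K).L : ℕ) : ℂ) ^ (0 : ℕ)) • bondAvgIter 0 Y b := h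
    rw [ChartKernelFlat.logTower_zero _ _ b hsmall, pow_zero, mul_one, bondAvgIter_zero, Pi.smul_apply] at h'
    exact smul_right_injective (Matrix (Fin 2) (Fin 2) ℂ) hηne h'
  have hZ0 : ∀ b : PBond (F.P K) 0, Dm.LamBond 0 b → Near b → (X - H (D X)) b = (A - H (D A)) b := fun b hb _ => by
    rw [hZ X hXS b hb, hZ A hAS b hb]
    simpa only [bondAvgIter_zero] using hXQ ⟨⟨⟨0, Nat.succ_pos _⟩, b⟩, hb⟩
  exact exists_gaugeAct_mem_fibre_local Dm hDk hcollar hw hR hnK hε₀ hε hUmin uS Near hNearIdx hNearΩ (A - H (D A)) (X - H (D X)) (hball A hAS) (hball X hXS)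
    hlog hZ0 W hWnear hWfar hchartNear hWreg

end Chart49

end Summit.QuantumFields.YangMills.Theorems.HalvingCompetitorMapFibreLocal

end
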